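import Summits.BirchSwinnertonDyer.Rank1Residual.Supersingular.MazurTateConstantTerms
import Summits.BirchSwinnertonDyer.Rank1Residual.Supersingular.MazurTateLayerConsistency
import Summits.BirchSwinnertonDyer.Rank1Residual.Supersingular.SharpFlatRankZeroReal
import HarnessLib

/-!
# `μ` from the trivial character and the UNIT case on real objects: `ord_p θ_n(0)` exactly at
# `a_p = 0`, `μ(Θ_n) ≤ ord_p θ_n(0)`, `μ(L^•) ≤ ord_p(c_•[0]⁺_f)`, and `ord_p[0]⁺_f = 0 ⇒ L^• ∈ Λ^×`
# ⇒ `λ(θ_n) = q_n`, `μ(θ_n) = 0` at EVERY layer (Kurihara's pattern; X8 and `a_p = 0`)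
# (cell `b2b-bsdres`, supersingular family, prover B = unit `b2b-bsdres-additive-p3`, gen 11; part 2)

HONEST FRAMING (run/shared/lean/b2b/bsd-rank1-residual/, verbatim in every file): the goal of the
cell is to DELETE the COMBINATION-SHAPED residual classes of the Birch–Swinnerton-Dyer formula for
ALL analytic-rank `≤ 1` elliptic curves over `ℚ` — "full BSD formula for every rank `≤ 1` curve in
class `C`" assembled STRICTLY from published theorems — so that the rank-`≤ 1` remainder becomes
exactly the CONSTRUCTION-SHAPED classes, which are TYPED (missing-input `Prop`s), NOT attempted.
This is not "finishing BSD". THEOREMS ONLY (no definition, no named fact, no `sorry`) over the tree's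
REAL objects (`θ_n`, `[0]⁺_f`, Sprung's pair `IsSprungPair`, the cell's `μ`/`λ` on `Λ = ℤ_p⟦T⟧`);
nothing about any particular curve is asserted; nothing is booked; X8 / X7 / X6 stay CONSTRUCTION-SHAPED.

## What this file proves, and why (memo `HOME/b2b-bsdres-additive-p3/X8-ROUTE-B.md` §16)

* §1 **`a_p = 0`: `ord_p(θ_n(0)) = ⌊n/2⌋ + ord_p([0]⁺_f)` exactly** (`p` odd, `L(f,1) ≠ 0`; part 1's
  closed form `θ_{2i}(0) = −2(−p)^i[0]⁺`, `θ_{2i+1}(0) = (1−p)(−p)^i[0]⁺`).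
* §2 **`μ` FROM THE TRIVIAL CHARACTER (analytic rank `0`)**: `p^{μ(G)} ∣ G` bounds `μ(G)` by the
  valuation of ANY coefficient read through a rational image (`mu_le_padicValRat_of_coeff_eq`); so for
  an integral model `Θ` of `ϖ·θ_{n+1}`: **`μ(Θ) ≤ ord_p ϖ + ord_p e_{n+1} + ord_p [0]⁺_f`**; at
  `a_p = 0`: `μ(Θ_n) ≤ ⌊n/2⌋ + ord_p[0]⁺_f`; for Sprung's pair via (P•) (gen 3,
  `constantCoeff_chromaticL_of_isSprungPair`): **`μ(L^•) ≤ ord_p(c_•) + ord_p([0]⁺_f)`**, on X8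
  **`μ(L♯), μ(L♭) ≤ ord_3([0]⁺_f)`** (`c_• ∈ {−1, −13, 5}`, `ClassX8.not_dvd_chromaticConst'`).
* §3 **THE UNIT CASE on real objects**: `ord_p([0]⁺_f) = 0` and `p ∤ c_•` ⟹ **`L^•` is a UNIT of
  `Λ`** (`isUnit_chromaticL_of_padicValRat_ratPlusSymbol_zero_eq_zero`), `μ(L^•) = λ(L^•) = 0`; on X8
  and at `a_p = 0` BOTH colours; whence by gen 4's single-layer exactness
  (`lam_mazurTate_eq_of_lam_sharp/flat`) **EVERY `θ_n` has `μ(θ_n) = 0` and `λ(θ_n) = deg ω_n^±`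
  (`= q_n`)** — KURIHARA'S PATTERN (Invent. Math. 149 (2002) Thm. 0.1: `L(E,1)/Ω` a `p`-unit ⇒
  `μ(θ_n) = 0`, `λ(θ_n) = q_n`) as a kernel theorem on the tree's objects; it DISCHARGES the hypothesis
  `IsUnit (chromaticL …)` of gen 6's `isOfFinAddOrder_layer_of_isUnit_of_kato` from ONE exact rational
  datum `ord_p([0]⁺_f) = 0` (modular symbols) — no coefficient scan, no twisted value.

For iw-2 / hyp: rank-`0` per-row bound `μ(θ_n) ≤ ord_3(e_n) + ord_3([0]⁺)`; where `ord_3([0]⁺_f) = 0`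
the certified prediction `(μ, λ)(θ_n) = (0, q_n)` at EVERY layer. Analytic side only; labels unchanged.

References: [Kurihara2002] Thm. 0.1; [Pollack2003] Prop. 6.9–6.10; [Sprung2017] Cor. 4.11 (table);
[Kobayashi2003] (3.6); [GreenbergVatsal2000] p. 2 (2); [Washington1997] §7.1. Memo: X8-ROUTE-B.md §16.
-/

set_option autoImplicit false

noncomputable section

open scoped Classical MatrixGroups ModularForm

open CongruenceSubgroup Polynomial WeierstrassCurve Literature.NumberTheory.EllipticCurves
  Literature.NumberTheory.EllipticCurves.ModularForms
  Literature.NumberTheory.EllipticCurves.Sprung2017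
  Literature.NumberTheory.EllipticCurves.Rank1Residual
  Summit.BirchSwinnertonDyer.Rank1Residual.X1.MuLambda
  Summit.BirchSwinnertonDyer.Rank1Residual.Iwasawa

namespace Summit.BirchSwinnertonDyer.Rank1Residual.Supersingular

/-! ## §1. `a_p = 0`: the exact valuation of the trivial-character column -/

section Valuation

variable {N : ℕ} [NeZero N] {f : CuspForm (Gamma0 N) 2} {p : ℕ} [hp : Fact p.Prime]

/-- **`a_p = 0`: `ord_p(θ_n(0)) = ⌊n/2⌋ + ord_p([0]⁺_f)` exactly** (`p` odd, `[0]⁺_f ≠ 0`, i.e.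
`L(f,1) ≠ 0`): the constant term of the layer-`n` Mazur–Tate element is divisible by EXACTLY
`p^{⌊n/2⌋}` more than `L(f,1)/Ω⁺_f`. [cite: MazurTateTeitelbaum1986Invent, §I.8 (8.6) and §I.10 Prop. (10.2)] [cite: Pollack2003, Prop. 6.9–6.10] -/
theorem padicValRat_eval_zero_mazurTateElement_of_ap_eq_zero (hp2 : p ≠ 2) (hf0 : IsNewform0 f)
    (hQ : coeffField f = ⊥) (hpN : ¬ p ∣ N) (hap : cuspCoeff f p = ((0 : ℤ) : ℂ))
    (hr : ratPlusSymbol f 0 ≠ 0) (n : ℕ) :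
    padicValRat p ((mazurTateElement f p n).eval 0) = (n / 2 : ℕ) + padicValRat p (ratPlusSymbol f 0) := by
  have hp1 : 1 < p := hp.out.one_lt
  have hpq : (p : ℚ) ≠ 0 := by exact_mod_cast hp.out.ne_zero
  have hvp : padicValRat p (-(p : ℚ)) = 1 := by rw [padicValRat.neg, padicValRat.self hp1]
  have hvpow : ∀ i : ℕ, padicValRat p ((-(p : ℚ)) ^ i) = i := by
    intro i; rw [padicValRat.pow, hvp, mul_one]
  have hv2 : padicValRat p (-2 : ℚ) = 0 := by
    rw [padicValRat.neg, show (2 : ℚ) = ((2 : ℕ) : ℚ) by norm_num, padicValRat.of_nat]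
    have : padicValNat p 2 = 0 :=
      padicValNat.eq_zero_of_not_dvd fun h ↦ hp2 ((Nat.prime_dvd_prime_iff_eq hp.out Nat.prime_two).mp h)
    exact_mod_cast this
  have hv1p : padicValRat p (1 - p : ℚ) = 0 := by
    rw [show (1 - p : ℚ) = -(((p - 1 : ℕ) : ℚ)) by push_cast [Nat.cast_sub hp1.le]; ring, padicValRat.neg,
      padicValRat.of_nat]
    have : padicValNat p (p - 1) = 0 :=
      padicValNat.eq_zero_of_not_dvd fun h ↦ by
        have := Nat.le_of_dvd (by omega) h
        omega
    exact_mod_cast this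
  obtain ⟨i, rfl | rfl⟩ := Nat.even_or_odd' n
  · rw [(eval_zero_mazurTateElement_of_ap_eq_zero hp2 hf0 hQ hpN hap i).1,
      padicValRat.mul (mul_ne_zero (by norm_num) (pow_ne_zero _ (neg_ne_zero.mpr hpq))) hr,
      padicValRat.mul (by norm_num) (pow_ne_zero _ (neg_ne_zero.mpr hpq)), hv2, hvpow,
      Nat.mul_div_cancel_left i two_pos]
    ring
  · have h1p : (1 - p : ℚ) ≠ 0 := by
      have : (1 : ℚ) < p := by exact_mod_cast hp1
      linarith
    rw [(eval_zero_mazurTateElement_of_ap_eq_zero hp2 hf0 hQ hpN hap i).2,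
      padicValRat.mul (mul_ne_zero h1p (pow_ne_zero _ (neg_ne_zero.mpr hpq))) hr,
      padicValRat.mul h1p (pow_ne_zero _ (neg_ne_zero.mpr hpq)), hv1p, hvpow,
      show (2 * i + 1) / 2 = i by omega]
    ring

end Valuation

/-! ## §2. `μ` from the trivial character (analytic rank `0`) -/

section MuBounds

variable {p : ℕ} [hp : Fact p.Prime]

/-- If `p^m ∣ G` in `Λ` then every coefficient of `ι(G) ∈ ℚ_p⟦T⟧` has norm `≤ p^{−m}`. [folklore] -/
theorem norm_coeff_iwasawaToPowerSeries_le_of_C_pow_dvd {G : IwasawaAlgebra p} {m : ℕ}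
    (h : PowerSeries.C ((p : ℤ_[p]) ^ m) ∣ G) (n : ℕ) :
    ‖PowerSeries.coeff n (iwasawaToPowerSeries p G)‖ ≤ (p : ℝ) ^ (-(m : ℤ)) := by
  obtain ⟨q, rfl⟩ := h
  rw [iwasawaToPowerSeries, PowerSeries.coeff_map, PowerSeries.coeff_C_mul, map_mul, map_pow,
    map_natCast, norm_mul, norm_pow, Padic.norm_p, zpow_neg, zpow_natCast, ← inv_pow]
  exact mul_le_of_le_one_right (by positivity) (PadicInt.norm_le_one _)

/-- **`μ(G) ≤ ord_p` of any coefficient**, read through a rational image: if the `n`-th coefficient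
of `ι(G)` is the image of a rational `q ≠ 0`, then `μ(G) ≤ ord_p(q)` (`p^{μ(G)}` divides `G`).
[cite: GreenbergVatsal2000, p. 2, (2)] -/
theorem mu_le_padicValRat_of_coeff_eq {G : IwasawaAlgebra p} {n : ℕ} {q : ℚ} (hq : q ≠ 0)
    (h : PowerSeries.coeff n (iwasawaToPowerSeries p G) = (q : ℚ_[p])) :
    (mu G : ℤ) ≤ padicValRat p q := by
  have hp1 : (1 : ℝ) < p := by exact_mod_cast hp.out.one_lt
  have hG : G ≠ 0 := by
    rintro rfl
    rw [map_zero, map_zero, eq_comm, Rat.cast_eq_zero] at h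
    exact hq h
  have hle := norm_coeff_iwasawaToPowerSeries_le_of_C_pow_dvd (C_pow_mu_dvd hG) n
  rw [h, Padic.eq_padicNorm, padicNorm.eq_zpow_of_nonzero hq] at hle
  push_cast at hle
  exact neg_le_neg_iff.mp ((zpow_le_zpow_iff_right₀ hp1).mp hle)

variable {N : ℕ} [NeZero N] {f : CuspForm (Gamma0 N) 2}

/-- **`μ` of a Mazur–Tate model from its constant term.** `Θ ∈ Λ` with `ι(Θ) = ϖ·θ_{n+1}` (an integral
model of `θ_{n+1}` scaled by a rational `ϖ ≠ 0`), `[0]⁺_f ≠ 0` (`L(f,1) ≠ 0`) and `e_{n+1} ≠ 0`: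
**`μ(Θ) ≤ ord_p(ϖ·e_{n+1}·[0]⁺_f) = ord_p ϖ + ord_p e_{n+1} + ord_p [0]⁺_f`**.
[cite: MazurTateTeitelbaum1986Invent, §I.8 (8.6) and §I.10 Prop. (10.2)] [cite: GreenbergVatsal2000, p. 2, (2)] -/
theorem mazurTate_mu_le_padicValRat_constantTerm (hp2 : p ≠ 2) (hf0 : IsNewform0 f)
    (hQ : coeffField f = ⊥) (hpN : ¬ p ∣ N) {ap : ℤ} (hap : cuspCoeff f p = ap) {c : ℕ → ℤ}
    (hc0 : c 0 = 1) (hc1 : c 1 = ap) (hrec : ∀ j, c (j + 2) = ap * c (j + 1) - p * c j) {n : ℕ}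
    {ϖ : ℚ} (hϖ : ϖ ≠ 0) (hr : ratPlusSymbol f 0 ≠ 0) (he : c (n + 2) - 2 * c (n + 1) + c n ≠ 0)
    {Θ : IwasawaAlgebra p}
    (hΘ : iwasawaToPowerSeries p Θ = PowerSeries.C (ϖ : ℚ_[p]) *
      ((mazurTateElement f p (n + 1)).map (algebraMap ℚ ℚ_[p]) : PowerSeries ℚ_[p])) :
    (mu Θ : ℤ) ≤ padicValRat p (ϖ * (((c (n + 2) - 2 * c (n + 1) + c n : ℤ) : ℚ) * ratPlusSymbol f 0)) := by
  refine mu_le_padicValRat_of_coeff_eq (n := 0) (mul_ne_zero hϖ (mul_ne_zero (by exact_mod_cast he) hr)) ?_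
  rw [hΘ, ← eval_zero_mazurTateElement_succ hp2 hf0 hQ hpN hap hc0 hc1 hrec n, PowerSeries.coeff_C_mul,
    Polynomial.coeff_coe, Polynomial.coeff_map, Polynomial.coeff_zero_eq_eval_zero]
  push_cast
  rw [eq_ratCast]

/-- **`a_p = 0`: `μ(Θ_n) ≤ ⌊n/2⌋ + ord_p([0]⁺_f)`** for any integral model `Θ_n` of `θ_n` (`p` odd,
`L(f,1) ≠ 0`). [cite: Pollack2003, Prop. 6.9–6.10] [cite: GreenbergVatsal2000, p. 2, (2)] -/
theorem mazurTate_mu_le_of_ap_eq_zero (hp2 : p ≠ 2) (hf0 : IsNewform0 f)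
    (hQ : coeffField f = ⊥) (hpN : ¬ p ∣ N) (hap : cuspCoeff f p = ((0 : ℤ) : ℂ))
    (hr : ratPlusSymbol f 0 ≠ 0) {n : ℕ} {Θ : IwasawaAlgebra p}
    (hΘ : iwasawaToPowerSeries p Θ =
      ((mazurTateElement f p n).map (algebraMap ℚ ℚ_[p]) : PowerSeries ℚ_[p])) :
    (mu Θ : ℤ) ≤ (n / 2 : ℕ) + padicValRat p (ratPlusSymbol f 0) := by
  rw [← padicValRat_eval_zero_mazurTateElement_of_ap_eq_zero hp2 hf0 hQ hpN hap hr n]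
  have hne : (mazurTateElement f p n).eval 0 ≠ 0 := by
    intro h0
    have h := padicValRat_eval_zero_mazurTateElement_of_ap_eq_zero hp2 hf0 hQ hpN hap hr n
    have hp1 : 1 < p := hp.out.one_lt
    have hpq : (p : ℚ) ≠ 0 := by exact_mod_cast hp.out.ne_zero
    obtain ⟨i, rfl | rfl⟩ := Nat.even_or_odd' n
    · rw [(eval_zero_mazurTateElement_of_ap_eq_zero hp2 hf0 hQ hpN hap i).1] at h0
      exact (mul_ne_zero (mul_ne_zero (by norm_num) (pow_ne_zero _ (neg_ne_zero.mpr hpq))) hr) h0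
    · rw [(eval_zero_mazurTateElement_of_ap_eq_zero hp2 hf0 hQ hpN hap i).2] at h0
      have h1p : (1 - p : ℚ) ≠ 0 := by
        have : (1 : ℚ) < p := by exact_mod_cast hp1
        linarith
      exact (mul_ne_zero (mul_ne_zero h1p (pow_ne_zero _ (neg_ne_zero.mpr hpq))) hr) h0
  refine mu_le_padicValRat_of_coeff_eq (n := 0) hne ?_
  rw [hΘ, Polynomial.coeff_coe, Polynomial.coeff_map, Polynomial.coeff_zero_eq_eval_zero, eq_ratCast]

/-- **`μ(L^•) ≤ ord_p(c_•·[0]⁺_f)` for Sprung's pair** (`p` odd good, `L(f,1) ≠ 0`, `c_• ≠ 0`), by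
(P•) `L^•(0) = c_•·[0]⁺_f` (`constantCoeff_chromaticL_of_isSprungPair`).
[cite: Sprung2017, Cor. 4.11 (table of special values)] [cite: GreenbergVatsal2000, p. 2, (2)] -/
theorem mu_chromaticL_le_padicValRat (hp2 : p ≠ 2) (hf0 : IsNewform0 f)
    (hQ : coeffField f = ⊥) (hpN : ¬ p ∣ N) {ap : ℤ} (hap : cuspCoeff f p = ap)
    {Lsharp Lflat : IwasawaAlgebra p} (hSP : IsSprungPair f p ap Lsharp Lflat) (c : Chroma)
    (hc : chromaticConst p ap c ≠ 0) (hr : ratPlusSymbol f 0 ≠ 0) :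
    (mu (chromaticL c Lsharp Lflat) : ℤ) ≤
      padicValRat p (((chromaticConst p ap c : ℤ) : ℚ) * ratPlusSymbol f 0) := by
  refine mu_le_padicValRat_of_coeff_eq (n := 0) (mul_ne_zero (by exact_mod_cast hc) hr) ?_
  rw [PowerSeries.coeff_zero_eq_constantCoeff, constantCoeff_iwasawaToPowerSeries,
    constantCoeff_chromaticL_of_isSprungPair hp2 hf0 hQ hpN hap hSP c]
  push_cast
  rfl

variable {W : WeierstrassCurve ℚ} [W.IsElliptic] [W.IsGloballyMinimal]

/-- **X8: `μ(L♯), μ(L♭) ≤ ord_3([0]⁺_f)`** in analytic rank `0` — both chromatic constants are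
`3`-adic units (`c_• ∈ {−1, −13, 5}`, `ClassX8.not_dvd_chromaticConst'`). [cite: Sprung2017, Cor. 4.11 (table of special values)] [cite: GreenbergVatsal2000, p. 2, (2)] -/
theorem ClassX8.mu_chromaticL_le (hX : ClassX8 W p) (hf : IsNewformOf W f)
    {Lsharp Lflat : IwasawaAlgebra p} (hSP : IsSprungPair f p (W.frobeniusTrace p) Lsharp Lflat)
    (c : Chroma) (hr : ratPlusSymbol f 0 ≠ 0) :
    (mu (chromaticL c Lsharp Lflat) : ℤ) ≤ padicValRat p (ratPlusSymbol f 0) := by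
  have hp3 : p = 3 := hX.1
  subst hp3
  have hgood : W.HasGoodReductionAtPrime 3 := hX.2.1.1
  have hp2 : (3 : ℕ) ≠ 2 := by decide
  have hc := ClassX8.not_dvd_chromaticConst' W 3 hX c
  have hc0 : chromaticConst 3 (W.frobeniusTrace 3) c ≠ 0 := fun h ↦ hc (by rw [h]; exact dvd_zero _)
  have h := mu_chromaticL_le_padicValRat hp2 hf.1 hf.coeffField_eq_bot
    (not_dvd_level_of_isNewformOf hf hgood) (cuspCoeff_eq_frobeniusTrace_of_isNewformOf_holds hf hgood)
    hSP c hc0 hr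
  rwa [padicValRat.mul (by exact_mod_cast hc0) hr, padicValRat.of_int,
    padicValInt.eq_zero_of_not_dvd hc, Nat.cast_zero, zero_add] at h

end MuBounds

/-! ## §3. The unit case on real objects: `ord_p([0]⁺_f) = 0 ⇒ L^• ∈ Λ^×` (Kurihara's pattern) -/

section UnitCase

variable {p : ℕ} [hp : Fact p.Prime]

/-- An element of `Λ` whose constant term is (the image of) a rational number of `p`-adic valuation
`0` is a UNIT of `Λ`. [folklore] -/
theorem isUnit_of_constantCoeff_eq_ratCast {L : IwasawaAlgebra p} {q : ℚ} (hq : q ≠ 0)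
    (hv : padicValRat p q = 0)
    (h : ((PowerSeries.constantCoeff L : ℤ_[p]) : ℚ_[p]) = (q : ℚ_[p])) : IsUnit L := by
  rw [PowerSeries.isUnit_iff_constantCoeff, PadicInt.isUnit_iff, PadicInt.norm_def, h,
    Padic.eq_padicNorm, padicNorm.eq_zpow_of_nonzero hq, hv, neg_zero, zpow_zero, Rat.cast_one]

variable {N : ℕ} [NeZero N] {f : CuspForm (Gamma0 N) 2}

/-- **`ord_p([0]⁺_f) = 0` and `p ∤ c_•` ⟹ `L^•` is a unit of `Λ`**, hence `μ(L^•) = λ(L^•) = 0`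
(`p` odd good; (P•) on real objects). [cite: Sprung2017, Cor. 4.11 (table of special values)] -/
theorem isUnit_chromaticL_of_padicValRat_ratPlusSymbol_zero_eq_zero (hp2 : p ≠ 2)
    (hf0 : IsNewform0 f) (hQ : coeffField f = ⊥) (hpN : ¬ p ∣ N) {ap : ℤ} (hap : cuspCoeff f p = ap)
    {Lsharp Lflat : IwasawaAlgebra p} (hSP : IsSprungPair f p ap Lsharp Lflat) (c : Chroma)
    (hc : ¬ (p : ℤ) ∣ chromaticConst p ap c) (hr : ratPlusSymbol f 0 ≠ 0)
    (hv : padicValRat p (ratPlusSymbol f 0) = 0) : IsUnit (chromaticL c Lsharp Lflat) := by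
  have hc0 : chromaticConst p ap c ≠ 0 := fun h ↦ hc (by rw [h]; exact dvd_zero _)
  refine isUnit_of_constantCoeff_eq_ratCast (q := (chromaticConst p ap c : ℚ) * ratPlusSymbol f 0)
    (mul_ne_zero (by exact_mod_cast hc0) hr) ?_ ?_
  · rw [padicValRat.mul (by exact_mod_cast hc0) hr, hv, add_zero, padicValRat.of_int,
      padicValInt.eq_zero_of_not_dvd hc, Nat.cast_zero]
  · rw [constantCoeff_chromaticL_of_isSprungPair hp2 hf0 hQ hpN hap hSP c]
    push_cast
    rfl

/-- The same with the `(μ, λ) = (0, 0)` reading: `L^• ≠ 0 ∧ μ(L^•) = 0 ∧ λ(L^•) = 0`.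
[cite: Sprung2017, Cor. 4.11 (table of special values)] [cite: Washington1997, §7.1] -/
theorem mu_lam_chromaticL_eq_zero_of_padicValRat_ratPlusSymbol_zero_eq_zero (hp2 : p ≠ 2)
    (hf0 : IsNewform0 f) (hQ : coeffField f = ⊥) (hpN : ¬ p ∣ N) {ap : ℤ} (hap : cuspCoeff f p = ap)
    {Lsharp Lflat : IwasawaAlgebra p} (hSP : IsSprungPair f p ap Lsharp Lflat) (c : Chroma)
    (hc : ¬ (p : ℤ) ∣ chromaticConst p ap c) (hr : ratPlusSymbol f 0 ≠ 0)
    (hv : padicValRat p (ratPlusSymbol f 0) = 0) :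
    chromaticL c Lsharp Lflat ≠ 0 ∧ mu (chromaticL c Lsharp Lflat) = 0 ∧
      lam (chromaticL c Lsharp Lflat) = 0 :=
  (isUnit_iff_mu_eq_zero_and_lam_eq_zero _).mp
    (isUnit_chromaticL_of_padicValRat_ratPlusSymbol_zero_eq_zero hp2 hf0 hQ hpN hap hSP c hc hr hv)

variable {W : WeierstrassCurve ℚ} [W.IsElliptic] [W.IsGloballyMinimal]

/-- **`a_p = 0` (X6/X7): `ord_p([0]⁺_f) = 0` ⟹ BOTH `L♯` (`= L⁺`) and `L♭` (`= L⁻`) are units of `Λ`**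
(`c_♯ = p − 1`, `c_♭ = 2`, `p` odd). [cite: Sprung2017, Cor. 4.11 (table of special values)] [cite: Kobayashi2003, (3.6) (p. 7)] -/
theorem isUnit_chromaticL_of_frobeniusTrace_eq_zero (hp2 : p ≠ 2) (hf : IsNewformOf W f)
    (hgood : W.HasGoodReductionAtPrime p) (hap : W.frobeniusTrace p = 0)
    {Lsharp Lflat : IwasawaAlgebra p} (hSP : IsSprungPair f p (W.frobeniusTrace p) Lsharp Lflat)
    (c : Chroma) (hr : ratPlusSymbol f 0 ≠ 0) (hv : padicValRat p (ratPlusSymbol f 0) = 0) :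
    IsUnit (chromaticL c Lsharp Lflat) := by
  refine isUnit_chromaticL_of_padicValRat_ratPlusSymbol_zero_eq_zero hp2 hf.1 hf.coeffField_eq_bot
    (not_dvd_level_of_isNewformOf hf hgood) (cuspCoeff_eq_frobeniusTrace_of_isNewformOf_holds hf hgood)
    hSP c ?_ hr hv
  rw [hap, chromaticConst_zero]
  have hp2' : ¬ (p : ℤ) ∣ 2 := fun h ↦ hp2 ((Nat.prime_dvd_prime_iff_eq hp.out Nat.prime_two).mp
    (by exact_mod_cast h))
  cases c with
  | sharp =>
    intro h
    have : (p : ℤ) ∣ 1 := by simpa using (dvd_refl (p : ℤ)).sub h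
    exact hp.out.ne_one (by exact_mod_cast Int.eq_one_of_dvd_one (Int.natCast_nonneg p) this)
  | flat => exact hp2'

/-- **X8: `ord_3([0]⁺_f) = 0` ⟹ BOTH `L♯` and `L♭` are units of `Λ`** (`c_• ∈ {−1, −13, 5}`).
[cite: Sprung2017, Cor. 4.11 (table of special values)] -/
theorem ClassX8.isUnit_chromaticL (hX : ClassX8 W p) (hf : IsNewformOf W f)
    {Lsharp Lflat : IwasawaAlgebra p} (hSP : IsSprungPair f p (W.frobeniusTrace p) Lsharp Lflat)
    (c : Chroma) (hr : ratPlusSymbol f 0 ≠ 0) (hv : padicValRat p (ratPlusSymbol f 0) = 0) :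
    IsUnit (chromaticL c Lsharp Lflat) := by
  have hp3 : p = 3 := hX.1
  subst hp3
  have hgood : W.HasGoodReductionAtPrime 3 := hX.2.1.1
  have hp2 : (3 : ℕ) ≠ 2 := by decide
  exact isUnit_chromaticL_of_padicValRat_ratPlusSymbol_zero_eq_zero hp2 hf.1 hf.coeffField_eq_bot
    (not_dvd_level_of_isNewformOf hf hgood) (cuspCoeff_eq_frobeniusTrace_of_isNewformOf_holds hf hgood)
    hSP c (ClassX8.not_dvd_chromaticConst' W 3 hX c) hr hv

/-- **KURIHARA'S PATTERN ON X8, odd layers (real objects)**: `ClassX8`, `f` the newform of `W`,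
`(L♯, L♭)` ANY Sprung pair, `ord_3([0]⁺_f) = 0`. Then for every ODD `n`, every integral model `Θ` of
`θ_n` has **`Θ ≠ 0`, `μ(Θ) = 0` and `λ(Θ) = deg ω_n^+`** (`= q_n`): `L♯` is a unit (`λ♯ = μ♯ = 0`)
and gen 4's single-layer exactness `lam_mazurTate_eq_of_lam_sharp` applies at every odd layer
(`deg ω_n^+ < 3ⁿ`). [cite: Kurihara2002, Thm. 0.1] [cite: Pollack2003, Prop. 6.9–6.10] -/
theorem ClassX8.mu_eq_zero_and_lam_eq_of_odd_of_padicValRat_eq_zero (hX : ClassX8 W p)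
    (hf : IsNewformOf W f) {Lsharp Lflat : IwasawaAlgebra p}
    (hSP : IsSprungPair f p (W.frobeniusTrace p) Lsharp Lflat) (hr : ratPlusSymbol f 0 ≠ 0)
    (hv : padicValRat p (ratPlusSymbol f 0) = 0) {n : ℕ} (hn : Odd n) {Θ : IwasawaAlgebra p}
    (hΘ : iwasawaToPowerSeries p Θ =
      ((mazurTateElement f p n).map (algebraMap ℚ ℚ_[p]) : PowerSeries ℚ_[p])) :
    Θ ≠ 0 ∧ mu Θ = 0 ∧ lam Θ = (cyclotomicOmegaPlus p n).natDegree := by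
  have hp3 : p = 3 := hX.1
  subst hp3
  have hgood : W.HasGoodReductionAtPrime 3 := hX.2.1.1
  have hap : ((3 : ℕ) : ℤ) ∣ W.frobeniusTrace 3 := hX.2.1.2
  have hp2 : (3 : ℕ) ≠ 2 := by decide
  obtain ⟨hL0, hμ, hlam⟩ := (isUnit_iff_mu_eq_zero_and_lam_eq_zero _).mp
    (ClassX8.isUnit_chromaticL hX hf hSP Chroma.sharp hr hv)
  rw [chromaticL_sharp] at hL0 hμ hlam
  have hlt : lam Lsharp + (cyclotomicOmegaPlus 3 n).natDegree < 3 ^ n := by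
    have := natDegree_cyclotomicOmegaPlus_add (p := 3) n
    omega
  obtain ⟨h1, h2, h3⟩ := lam_mazurTate_eq_of_lam_sharp hp2 hf hgood hap hSP hL0 hμ hn hlt hΘ
  exact ⟨h1, h2, by rw [h3, hlam, zero_add]⟩

/-- **KURIHARA'S PATTERN ON X8, even layers**: same hypotheses, `n` EVEN ⟹ every integral model `Θ`
of `θ_n` has `Θ ≠ 0`, `μ(Θ) = 0`, `λ(Θ) = deg ω_n^-`. [cite: Kurihara2002, Thm. 0.1] [cite: Pollack2003, Prop. 6.9–6.10] -/
theorem ClassX8.mu_eq_zero_and_lam_eq_of_even_of_padicValRat_eq_zero (hX : ClassX8 W p)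
    (hf : IsNewformOf W f) {Lsharp Lflat : IwasawaAlgebra p}
    (hSP : IsSprungPair f p (W.frobeniusTrace p) Lsharp Lflat) (hr : ratPlusSymbol f 0 ≠ 0)
    (hv : padicValRat p (ratPlusSymbol f 0) = 0) {n : ℕ} (hn : Even n) {Θ : IwasawaAlgebra p}
    (hΘ : iwasawaToPowerSeries p Θ =
      ((mazurTateElement f p n).map (algebraMap ℚ ℚ_[p]) : PowerSeries ℚ_[p])) :
    Θ ≠ 0 ∧ mu Θ = 0 ∧ lam Θ = (cyclotomicOmegaMinus p n).natDegree := by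
  have hp3 : p = 3 := hX.1
  subst hp3
  have hgood : W.HasGoodReductionAtPrime 3 := hX.2.1.1
  have hap : ((3 : ℕ) : ℤ) ∣ W.frobeniusTrace 3 := hX.2.1.2
  have hp2 : (3 : ℕ) ≠ 2 := by decide
  obtain ⟨hL0, hμ, hlam⟩ := (isUnit_iff_mu_eq_zero_and_lam_eq_zero _).mp
    (ClassX8.isUnit_chromaticL hX hf hSP Chroma.flat hr hv)
  rw [chromaticL_flat] at hL0 hμ hlam
  have hlt : lam Lflat + (cyclotomicOmegaMinus 3 n).natDegree < 3 ^ n := by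
    have := natDegree_cyclotomicOmegaPlus_add (p := 3) n
    omega
  obtain ⟨h1, h2, h3⟩ := lam_mazurTate_eq_of_lam_flat hp2 hf hgood hap hSP hL0 hμ hn hlt hΘ
  exact ⟨h1, h2, by rw [h3, hlam, zero_add]⟩

/-- **The same pattern at `a_p = 0` (X6/X7, every supersingular `p ≥ 5`), odd layers**: `f` the
newform of `W`, `p` odd good with `a_p = 0`, `(L♯, L♭)` any Sprung pair (= Pollack's `(L⁺, L⁻)`,
`SprungPollackConsistency`), `ord_p([0]⁺_f) = 0` ⟹ every integral model of `θ_n`, `n` odd, has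
`μ = 0` and `λ = deg ω_n^+ = q_n` (Kurihara 2002 / Pollack 2003: `λ(θ_n) = q_n` when `L(E,1)/Ω` is a
`p`-unit). [cite: Kurihara2002, Thm. 0.1] [cite: Pollack2003, Prop. 6.9–6.10] -/
theorem mu_eq_zero_and_lam_eq_of_odd_of_frobeniusTrace_eq_zero (hp2 : p ≠ 2) (hf : IsNewformOf W f)
    (hgood : W.HasGoodReductionAtPrime p) (hap0 : W.frobeniusTrace p = 0)
    {Lsharp Lflat : IwasawaAlgebra p} (hSP : IsSprungPair f p (W.frobeniusTrace p) Lsharp Lflat)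
    (hr : ratPlusSymbol f 0 ≠ 0) (hv : padicValRat p (ratPlusSymbol f 0) = 0) {n : ℕ} (hn : Odd n)
    {Θ : IwasawaAlgebra p}
    (hΘ : iwasawaToPowerSeries p Θ =
      ((mazurTateElement f p n).map (algebraMap ℚ ℚ_[p]) : PowerSeries ℚ_[p])) :
    Θ ≠ 0 ∧ mu Θ = 0 ∧ lam Θ = (cyclotomicOmegaPlus p n).natDegree := by
  have hap : (p : ℤ) ∣ W.frobeniusTrace p := by rw [hap0]; exact dvd_zero _
  obtain ⟨hL0, hμ, hlam⟩ := (isUnit_iff_mu_eq_zero_and_lam_eq_zero _).mp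
    (isUnit_chromaticL_of_frobeniusTrace_eq_zero hp2 hf hgood hap0 hSP Chroma.sharp hr hv)
  rw [chromaticL_sharp] at hL0 hμ hlam
  have hlt : lam Lsharp + (cyclotomicOmegaPlus p n).natDegree < p ^ n := by
    have := natDegree_cyclotomicOmegaPlus_add (p := p) n
    omega
  obtain ⟨h1, h2, h3⟩ := lam_mazurTate_eq_of_lam_sharp hp2 hf hgood hap hSP hL0 hμ hn hlt hΘ
  exact ⟨h1, h2, by rw [h3, hlam, zero_add]⟩

/-- `a_p = 0`, even layers: `μ(Θ) = 0`, `λ(Θ) = deg ω_n^-`. [cite: Kurihara2002, Thm. 0.1] [cite: Pollack2003, Prop. 6.9–6.10] -/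
theorem mu_eq_zero_and_lam_eq_of_even_of_frobeniusTrace_eq_zero (hp2 : p ≠ 2) (hf : IsNewformOf W f)
    (hgood : W.HasGoodReductionAtPrime p) (hap0 : W.frobeniusTrace p = 0)
    {Lsharp Lflat : IwasawaAlgebra p} (hSP : IsSprungPair f p (W.frobeniusTrace p) Lsharp Lflat)
    (hr : ratPlusSymbol f 0 ≠ 0) (hv : padicValRat p (ratPlusSymbol f 0) = 0) {n : ℕ} (hn : Even n)
    {Θ : IwasawaAlgebra p}
    (hΘ : iwasawaToPowerSeries p Θ =
      ((mazurTateElement f p n).map (algebraMap ℚ ℚ_[p]) : PowerSeries ℚ_[p])) :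
    Θ ≠ 0 ∧ mu Θ = 0 ∧ lam Θ = (cyclotomicOmegaMinus p n).natDegree := by
  have hap : (p : ℤ) ∣ W.frobeniusTrace p := by rw [hap0]; exact dvd_zero _
  obtain ⟨hL0, hμ, hlam⟩ := (isUnit_iff_mu_eq_zero_and_lam_eq_zero _).mp
    (isUnit_chromaticL_of_frobeniusTrace_eq_zero hp2 hf hgood hap0 hSP Chroma.flat hr hv)
  rw [chromaticL_flat] at hL0 hμ hlam
  have hlt : lam Lflat + (cyclotomicOmegaMinus p n).natDegree < p ^ n := by
    have := natDegree_cyclotomicOmegaPlus_add (p := p) n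
    omega
  obtain ⟨h1, h2, h3⟩ := lam_mazurTate_eq_of_lam_flat hp2 hf hgood hap hSP hL0 hμ hn hlt hΘ
  exact ⟨h1, h2, by rw [h3, hlam, zero_add]⟩

end UnitCase

end Summit.BirchSwinnertonDyer.Rank1Residual.Supersingular

end
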